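import Literature.NumberTheory.Automorphic.TwistedQuotientInducedInvariants
import Literature.NumberTheory.Automorphic.TwistedQuotientIndFunReduction
import Literature.NumberTheory.Automorphic.ArithmeticQuotientHeckeLocal
import HarnessLib

/-!
# Hecke operators on `M̃` and on its reduction `M̃/n = (Fun(𝒢/L', M/n))^{L/L'}`

Topic `NumberTheory/Automorphic`; namespace `Literature.NumberTheory.Automorphic.TwistedQuotient`.
Definitions with bodies and theorems; no named fact, no instance, no `sorry`.

The integral functions `M̃ = intFun ι L π M ⊂ Fun(𝒢 ⧸ L, V)_ρ` carry the Hecke operator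
`[L t L]` (`heckeIntHom`).  Untwisting (`intFunIso : M̃ ≅ indFun (latticeRep M)`), reducing modulo
`n` (`indFunMod`), and — when the reduction `σ̄ = σ mod n` of the lattice representation is trivial
on a smaller level `L' ≤ L` — descending (`toInvariants : indFun σ̄ ≅ W^{L/L'}`,
`W = Fun(𝒢 ⧸ L', M/n)`), one lands in the module on which the Hochschild–Serre nilpotence of
`TwistedQuotientLevelChangeNilpotent` / `TameLevelHeckeNilpotent` is available, with ITS Hecke
operator `[L' t L']` (`heckeProdTwistHom`).  This file proves that the two Hecke operators match
along this chain:

* `redFun f : 𝒢 ⧸ L' → M/n`, `gL' ↦ π(g)⁻¹ f(gL) mod n`, the composite on functions;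
* **`heckeFun_redFun`** — `[L' t L'] (redFun f) = redFun ([L t L] f)` provided `π(t) = 1`,
  `σ(l') ≡ 1 mod n` on `M` for `l' ∈ L'`, and `L' t L'/L' → L t L/L` is a bijection
  (for the tame tower: `TameLevel.bijOn_subgroup_heckeElement`, and
  `exists_forall_padicCoeffRep_sub_mem` for the congruence);
* **`φZ_heckeProdTwistHom_toInvariants_indFunMod`** — the same as an identity of elements of
  `W^{L/L'}`: `T_{L'} (F̄(f)) = F̄(T_L f)` where `F̄ = toInvariants ∘ indFunMod ∘ untwist`.

This is the compatibility "`𝕋(T_v)` acts on `H^i(X_K, ℳ_{ξ,K}/p^m)` through its action on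
`⊕ H^i(X_{K'}, ℤ/p^m)`" implicit in the proof of [Scholze2015, Thm. V.4.1].

## References

* P. Scholze, *On torsion in the cohomology of locally symmetric varieties*, Ann. of Math. 182
  (2015), §V.4, proof of Thm. V.4.1. [Scholze2015]
-/

noncomputable section

open CategoryTheory Literature.Algebra.Homology
open scoped Classical

universe u

namespace Literature.NumberTheory.Automorphic

namespace TwistedQuotient

variable {A : Type u} [CommRing A] {Γ 𝒢 : Type u} [Group Γ] [Group 𝒢] (ι : Γ →* 𝒢)
  {L' L : Subgroup 𝒢} (hle : L' ≤ L)
  {V : Type u} [AddCommGroup V] [Module A V] (π : Representation A 𝒢 V)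
  (M : Submodule A V) (hM : ∀ l ∈ L, ∀ m ∈ M, π l m ∈ M) (n : ℕ)

/-! ### The reduced lattice representation and its triviality on `L'` -/

/-- The hypothesis "`σ(l') ≡ 1 mod n` on `M` for `l' ∈ L'`" (e.g. `U_r` acting on `M/p^s`,
`exists_forall_padicCoeffRep_sub_mem`). [folklore] -/
def ModTrivialOn (K : Subgroup 𝒢) : Prop :=
  ∀ l : L, (l : 𝒢) ∈ K → ∀ m : M,
    latticeRep L π M hM l m - m ∈ nsmulSubmodule (A := A) (N := M) n

/-- Under `ModTrivialOn`, the reduction `σ mod n` is trivial on `K`. [folklore] -/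
theorem modRep_eq_one_of_modTrivialOn {K : Subgroup 𝒢} (hK : ModTrivialOn π M hM n K) (l : L)
    (hl : (l : 𝒢) ∈ K) : modRep L (latticeRep L π M hM) n l = 1 := by
  refine LinearMap.ext fun x => ?_
  induction x using Submodule.Quotient.induction_on with
  | H m =>
    rw [Module.End.one_apply, quotient_apply_mk, Submodule.Quotient.eq]
    exact hK l hl m

/-! ### The composite on functions -/

/-- Coercion into the lattice: `v ↦ ⟨v, _⟩` if `v ∈ M`, else `0` (avoids dependent sums). [folklore] -/
def toLattice (v : V) : M :=
  if h : v ∈ M then ⟨v, h⟩ else 0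

/-- On `M` the coercion is the identity. [folklore] -/
theorem coe_toLattice {v : V} (h : v ∈ M) : (toLattice M v : V) = v := by
  rw [toLattice, dif_pos h]

/-- `toLattice` of an element given with its membership proof. [folklore] -/
theorem toLattice_eq_mk {v : V} (h : v ∈ M) : toLattice M v = ⟨v, h⟩ :=
  Subtype.ext (coe_toLattice M h)

/-- `toLattice` is additive on finite sums of elements of `M`. [folklore] -/
theorem toLattice_sum {I : Type*} (s : Finset I) (v : I → V) (hv : ∀ i ∈ s, v i ∈ M) :
    toLattice M (∑ i ∈ s, v i) = ∑ i ∈ s, toLattice M (v i) := by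
  refine Subtype.ext ?_
  rw [coe_toLattice M (M.sum_mem hv), AddSubmonoidClass.coe_finsetSum]
  exact Finset.sum_congr rfl fun i hi => (coe_toLattice M (hv i hi)).symm

/-- `toLattice` commutes with `π(g)` on `M` when `π(g) M ⊆ M`. [folklore] -/
theorem toLattice_rep {g : 𝒢} (hg : ∀ m ∈ M, π g m ∈ M) {v : V} (hv : v ∈ M) :
    toLattice M (π g v) = ⟨π g v, hg v hv⟩ :=
  toLattice_eq_mk M (hg v hv)

/-- **The reduced untwisted function** `gL' ↦ π(g)⁻¹ f(gL) mod n` attached to `f ∈ M̃`: the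
descended function of `indFunMod (untwist f)`. [cite: Scholze2015, §V.4 (proof of Thm. V.4.1)] -/
def redFun (hL' : ModTrivialOn π M hM n L') (f : intFun ι L π M) :
    (𝒢 ⧸ L') → (M ⧸ nsmulSubmodule (A := A) (N := M) n) :=
  descFun ι hle (modRep L (latticeRep L π M hM) n) (modRep_eq_one_of_modTrivialOn π M hM n hL')
    ((indFunMod ι L (latticeRep L π M hM) n).hom (untwistFun ι L π M hM f))

/-- Value of `redFun f` at `gL'`. [folklore] -/
theorem redFun_mk (hL' : ModTrivialOn π M hM n L') (f : intFun ι L π M) (g : 𝒢) :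
    redFun ι hle π M hM n hL' f (g : 𝒢 ⧸ L') =
      Submodule.Quotient.mk (toLattice M (π g⁻¹ (f.1 (g : 𝒢 ⧸ L)))) := by
  rw [redFun, descFun_mk, indFunReduce_hom_apply_val, toLattice_eq_mk M (f.2 g)]
  rfl

/-! ### The Hecke operators match -/

variable {t : 𝒢} (ht : π t = 1)

include ht in
/-- `π(t) M ⊆ M` trivially when `π(t) = 1`. [folklore] -/
theorem rep_mem_of_eq_one (m : V) (hm : m ∈ M) : π t m ∈ M := by
  rw [ht, Module.End.one_apply]; exact hm

include hM ht in
/-- For `f ∈ M̃`, `a ∈ L`: `π(g)⁻¹ f(g a t L) ∈ M`. [folklore] -/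
theorem rep_inv_apply_mem (f : intFun ι L π M) (g : 𝒢) (a : L) :
    π g⁻¹ (f.1 ((g * (a * t) : 𝒢) : 𝒢 ⧸ L)) ∈ M := by
  have h := f.2 (g * (a * t))
  have key : π g⁻¹ (f.1 ((g * (a * t) : 𝒢) : 𝒢 ⧸ L)) =
      π ((a : 𝒢) * t) (π (g * (a * t))⁻¹ (f.1 ((g * (a * t) : 𝒢) : 𝒢 ⧸ L))) := by
    rw [← Module.End.mul_apply, ← map_mul]
    congr 2
    group
  rw [key, map_mul, Module.End.mul_apply]
  exact hM _ a.2 _ (rep_mem_of_eq_one π M ht _ h)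

include ht in
/-- `π(t⁻¹) = 1` on vectors when `π(t) = 1`. [folklore] -/
theorem rep_inv_apply_of_eq_one (w : V) : π t⁻¹ w = w := by
  conv_lhs => rw [← show π t w = w by rw [ht, Module.End.one_apply]]
  exact rep_inv_apply_apply π t w

include ht in
/-- For `a ∈ L'` (congruence level): `π(g a t)⁻¹ v ≡ π(g)⁻¹ v mod n`, precisely
`mk (toLattice (π (g a t)⁻¹ v)) = mk (toLattice (π g⁻¹ v))` when `π g⁻¹ v ∈ M`. [folklore] -/
theorem mk_toLattice_rep_inv_mul (hL' : ModTrivialOn π M hM n L') (g : 𝒢) (a : L)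
    (ha : (a : 𝒢) ∈ L') (v : V) (hv : π g⁻¹ v ∈ M) :
    (Submodule.Quotient.mk (toLattice M (π (g * (a * t))⁻¹ v)) :
        M ⧸ nsmulSubmodule (A := A) (N := M) n) =
      Submodule.Quotient.mk (toLattice M (π g⁻¹ v)) := by
  have h1 : π (g * (a * t))⁻¹ v = π (a : 𝒢)⁻¹ (π g⁻¹ v) := by
    rw [mul_inv_rev, mul_inv_rev, map_mul, map_mul, Module.End.mul_apply, Module.End.mul_apply,
      rep_inv_apply_of_eq_one π ht]
  have hmem : π (a : 𝒢)⁻¹ (π g⁻¹ v) ∈ M := hM _ (L.inv_mem a.2) _ hv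
  rw [h1, toLattice_eq_mk M hmem, toLattice_eq_mk M hv, Submodule.Quotient.eq]
  have h2 : (⟨π (a : 𝒢)⁻¹ (π g⁻¹ v), hmem⟩ : M) = latticeRep L π M hM a⁻¹ ⟨π g⁻¹ v, hv⟩ :=
    Subtype.ext (by rw [coe_latticeRep_apply, Subgroup.coe_inv])
  rw [h2]
  exact hL' a⁻¹ (by rw [Subgroup.coe_inv]; exact L'.inv_mem ha) _

/-- Elements of `L t L / L` are the cosets `(b t) L`, `b ∈ L`. [folklore] -/
theorem exists_eq_smul_of_mem_doubleCosetQuot {K : Subgroup 𝒢} {d : 𝒢 ⧸ K}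
    (hd : d ∈ ArithmeticQuotient.doubleCosetQuot K t) : ∃ b : K, d = ((((b : 𝒢) * t) : 𝒢) : 𝒢 ⧸ K) := by
  obtain ⟨b, hb⟩ := MulAction.mem_orbit_iff.1 hd
  refine ⟨b, ?_⟩
  rw [← hb]
  change ((b : 𝒢) • (t : 𝒢 ⧸ K) : 𝒢 ⧸ K) = _
  rw [MulAction.Quotient.smul_coe, smul_eq_mul]

/-- `g • (x K) = (g x) K`. [folklore] -/
theorem smul_mk_eq {K : Subgroup 𝒢} (g x : 𝒢) : (g • ((x : 𝒢) : 𝒢 ⧸ K) : 𝒢 ⧸ K) = ((g * x : 𝒢) : 𝒢 ⧸ K) := by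
  rw [MulAction.Quotient.smul_coe, smul_eq_mul]

include hM ht in
/-- **The Hecke operators match**: `[L' t L'] (redFun f) = redFun ([L t L] f)` at every coset,
provided `π(t) = 1`, `σ ≡ 1 mod n` on `L'`, and `L' t L'/L' → L t L/L` is a bijection.
[cite: Scholze2015, §V.4 (proof of Thm. V.4.1)] -/
theorem heckeFun_redFun (hL' : ModTrivialOn π M hM n L')
    (hbij : Set.BijOn (Subgroup.quotientMapOfLE hle) (ArithmeticQuotient.doubleCosetQuot L' t)
      (ArithmeticQuotient.doubleCosetQuot L t))
    (hfin : (ArithmeticQuotient.doubleCosetQuot L t).Finite)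
    (hfin' : (ArithmeticQuotient.doubleCosetQuot L' t).Finite)
    (f : intFun ι L π M) (g : 𝒢) :
    ArithmeticQuotient.heckeFun A L' t _ (redFun ι hle π M hM n hL' f) (g : 𝒢 ⧸ L') =
      redFun ι hle π M hM n hL' ((heckeIntHom ι L π M hM (rep_mem_of_eq_one π M ht)).hom f)
        (g : 𝒢 ⧸ L') := by
  rw [ArithmeticQuotient.heckeFun_apply_mk, dif_pos hfin', redFun_mk, val_heckeIntHom_hom_apply,
    ArithmeticQuotient.heckeFun_apply_mk, dif_pos hfin, map_sum]
  -- the summands on the left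
  have hterm : ∀ e ∈ hfin'.toFinset, redFun ι hle π M hM n hL' f (g • e) =
      Submodule.Quotient.mk (toLattice M (π g⁻¹ (f.1 (g • Subgroup.quotientMapOfLE hle e)))) := by
    intro e he
    rw [Set.Finite.mem_toFinset] at he
    obtain ⟨a, rfl⟩ := exists_eq_smul_of_mem_doubleCosetQuot he
    rw [smul_mk_eq, Subgroup.quotientMapOfLE_apply_mk, smul_mk_eq, redFun_mk, ← mul_assoc g]
    have hv := rep_inv_apply_mem ι π M hM ht f g ⟨a, hle a.2⟩
    rw [← mul_assoc g] at hv
    have h := mk_toLattice_rep_inv_mul π M hM n ht hL' g ⟨a, hle a.2⟩ a.2 _ hv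
    rw [← mul_assoc g] at h
    exact h
  -- membership of the summands on the right
  have hdmem : ∀ d ∈ hfin.toFinset, π g⁻¹ (f.1 (g • d)) ∈ M := by
    intro d hd
    rw [Set.Finite.mem_toFinset] at hd
    obtain ⟨b, rfl⟩ := exists_eq_smul_of_mem_doubleCosetQuot hd
    rw [smul_mk_eq, ← mul_assoc g]
    have hv := rep_inv_apply_mem ι π M hM ht f g b
    rw [← mul_assoc g] at hv
    exact hv
  -- reindex along the bijection `L' t L'/L' → L t L/L`
  have hi : ∀ e ∈ hfin'.toFinset, Subgroup.quotientMapOfLE hle e ∈ hfin.toFinset := fun e he => by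
    rw [Set.Finite.mem_toFinset] at he ⊢
    exact hbij.mapsTo he
  have hinj : Set.InjOn (Subgroup.quotientMapOfLE hle) (hfin'.toFinset : Set (𝒢 ⧸ L')) := by
    rw [Set.Finite.coe_toFinset]; exact hbij.injOn
  have hsurj : Set.SurjOn (Subgroup.quotientMapOfLE hle) (hfin'.toFinset : Set (𝒢 ⧸ L'))
      (hfin.toFinset : Set (𝒢 ⧸ L)) := by
    rw [Set.Finite.coe_toFinset, Set.Finite.coe_toFinset]; exact hbij.surjOn
  have hsum : ∑ e ∈ hfin'.toFinset, toLattice M (π g⁻¹ (f.1 (g • Subgroup.quotientMapOfLE hle e))) =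
      ∑ d ∈ hfin.toFinset, toLattice M (π g⁻¹ (f.1 (g • d))) :=
    Finset.sum_nbij (Subgroup.quotientMapOfLE hle) hi hinj hsurj (fun _ _ => rfl)
  rw [Finset.sum_congr rfl hterm, toLattice_sum M _ _ hdmem, ← hsum]
  exact (map_sum (nsmulSubmodule (A := A) (N := M) n).mkQ _ _).symm

/-! ### The same on the invariants `W^{L/L'}` -/

variable [hN : (L'.subgroupOf L).Normal]
  (hconj : ∀ l : L, ∃ a ∈ L', ∃ b ∈ L', (l : 𝒢) * t * (l : 𝒢)⁻¹ = a * t * b)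

include hM ht in
/-- **`T_{L'}` on `W^{L/L'}` matches `T_L` on `M̃`**: for `f ∈ M̃`, with
`F̄ = toInvariants (indFunMod (untwist f)) ∈ W^{L/L'}`, `[L' t L'] F̄(f) = F̄([L t L] f)`
(`φZ (heckeProdTwistHom t) 0` on the left, `heckeIntHom t` on the right).
[cite: Scholze2015, §V.4 (proof of Thm. V.4.1)] -/
theorem val_φZ_heckeProdTwistHom_toInvariants_intFun (hL' : ModTrivialOn π M hM n L')
    (hbij : Set.BijOn (Subgroup.quotientMapOfLE hle) (ArithmeticQuotient.doubleCosetQuot L' t)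
      (ArithmeticQuotient.doubleCosetQuot L t))
    (hfin : (ArithmeticQuotient.doubleCosetQuot L t).Finite)
    (hfin' : (ArithmeticQuotient.doubleCosetQuot L' t).Finite)
    (f : intFun ι L π M) (x : Fin 0 → L ⧸ L'.subgroupOf L) :
    ((φZ (inducedLevelProd ι hle (modRep L (latticeRep L π M hM) n)
          (modRep_eq_one_of_modTrivialOn π M hM n hL'))
        (heckeProdTwistHom ι hle (1 : Representation A Γ (M ⧸ nsmulSubmodule (A := A) (N := M) n))
          (quotRep (modRep L (latticeRep L π M hM) n) (modRep_eq_one_of_modTrivialOn π M hM n hL'))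
          (commute_one_quotRep _ _) hconj hfin') 0).hom
        (toInvariants ι hle _ (modRep_eq_one_of_modTrivialOn π M hM n hL')
          ((indFunMod ι L (latticeRep L π M hM) n).hom (untwistFun ι L π M hM f)))).1 x =
      (toInvariants ι hle _ (modRep_eq_one_of_modTrivialOn π M hM n hL')
          ((indFunMod ι L (latticeRep L π M hM) n).hom
            (untwistFun ι L π M hM ((heckeIntHom ι L π M hM (rep_mem_of_eq_one π M ht)).hom f)))).1
        x := by
  rw [val_φZ_heckeProdTwistHom_toInvariants, val_toInvariants]
  funext c
  induction c using QuotientGroup.induction_on with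
  | H g => exact heckeFun_redFun ι hle π M hM n ht hL' hbij hfin hfin' f g

/-- **The Hecke operator `[L t L]` transported to the induced module** `indFun (latticeRep M)`:
`intFunIso⁻¹ ≫ heckeIntHom t ≫ intFunIso`. [folklore] -/
def heckeIndHom (htM : ∀ m ∈ M, π t m ∈ M) :
    indFun ι L (latticeRep L π M hM) ⟶ indFun ι L (latticeRep L π M hM) :=
  (intFunIso ι L π M hM).inv ≫ heckeIntHom ι L π M hM htM ≫ (intFunIso ι L π M hM).hom

/-- `intFunIso` intertwines `heckeIntHom` and `heckeIndHom`. [folklore] -/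
@[reassoc]
theorem intFunIso_hom_comp_heckeIndHom (htM : ∀ m ∈ M, π t m ∈ M) :
    (intFunIso ι L π M hM).hom ≫ heckeIndHom ι π M hM htM =
      heckeIntHom ι L π M hM htM ≫ (intFunIso ι L π M hM).hom := by
  rw [heckeIndHom, Iso.hom_inv_id_assoc]

include ht in
/-- **Reduction intertwines the Hecke operators** (morphism form): on `indFun (latticeRep M)`,
`heckeIndHom t ≫ indFunMod ≫ iso = indFunMod ≫ iso ≫ φZ (heckeProdTwistHom t) 0`, where
`iso = indFunIsoInvariants : indFun (σ mod n) ≅ W^{L/L'}`. [cite: Scholze2015, §V.4 (proof of Thm. V.4.1)] -/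
theorem heckeIndHom_comp_indFunMod_comp (hL' : ModTrivialOn π M hM n L')
    (hbij : Set.BijOn (Subgroup.quotientMapOfLE hle) (ArithmeticQuotient.doubleCosetQuot L' t)
      (ArithmeticQuotient.doubleCosetQuot L t))
    (hfin : (ArithmeticQuotient.doubleCosetQuot L t).Finite)
    (hfin' : (ArithmeticQuotient.doubleCosetQuot L' t).Finite) :
    heckeIndHom ι π M hM (rep_mem_of_eq_one π M ht) ≫ indFunMod ι L (latticeRep L π M hM) n ≫
        (indFunIsoInvariants ι hle (modRep L (latticeRep L π M hM) n)
          (modRep_eq_one_of_modTrivialOn π M hM n hL')).hom =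
      indFunMod ι L (latticeRep L π M hM) n ≫
        (indFunIsoInvariants ι hle (modRep L (latticeRep L π M hM) n)
          (modRep_eq_one_of_modTrivialOn π M hM n hL')).hom ≫
        φZ (inducedLevelProd ι hle (modRep L (latticeRep L π M hM) n)
            (modRep_eq_one_of_modTrivialOn π M hM n hL'))
          (heckeProdTwistHom ι hle (1 : Representation A Γ (M ⧸ nsmulSubmodule (A := A) (N := M) n))
            (quotRep (modRep L (latticeRep L π M hM) n) (modRep_eq_one_of_modTrivialOn π M hM n hL'))
            (commute_one_quotRep _ _) hconj hfin') 0 := by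
  -- precompose with the isomorphism `intFunIso` and check on `f ∈ M̃`
  rw [← cancel_epi (intFunIso ι L π M hM).hom, intFunIso_hom_comp_heckeIndHom_assoc]
  refine Rep.hom_ext (Representation.IntertwiningMap.ext (LinearMap.ext fun f => ?_))
  refine Subtype.ext (funext fun x => ?_)
  exact (val_φZ_heckeProdTwistHom_toInvariants_intFun ι hle π M hM n ht hconj hL' hbij hfin hfin'
    f x).symm

end TwistedQuotient

end Literature.NumberTheory.Automorphic
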